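import Mathlib
import HarnessLib
import Summits.Ventures.LatticeQCDFlow.Scoring.ChainBlockAverages
import Summits.Ventures.LatticeQCDFlow.Scoring.ChainMartingaleIncrements
import Summits.Ventures.LatticeQCDFlow.Scoring.ChainIncrementFutureDecorrelation

/-!
# The block-boundary terms of the batch-means estimator are negligible at the CLT scale:
# `E[(Σ_{j<a} M_{bj,b} h(X_{bj}))²] ≤ a b C_h⁴`, `|E_z[M_{0,b} h(X_b)]| ≤ 4 C_h² A/(1−ρ)` and
# `E[(Σ_{j<a} (M_{bj,b} h(X_{bj+b}) − φ_b(X_{bj})))²] ≤ 4 a b C_h⁴`, from any start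

HONEST FRAMING: exact (Metropolis-corrected) sampling algorithms for lattice gauge theory;
figures of merit are autocorrelation/cost numbers at stated couplings and volumes; no
continuum-physics claim.

Venture `LatticeQCDFlow` (cell pub-lqcd), topic `Scoring`; FANOUT row 4 (`s0-u1-b`, GEN-30).
NEW WORK of the cell, not a published result; no definition is introduced; nothing is cited as a
fact.  Notation of `Scoring/ChainMartingaleIncrements.lean` (`P_{μ₀}` from ANY initial law,
`|h| ≤ C_h` measurable, `D_t`, `M_{s,n}`).  When `h` solves the Poisson equation the centred batch
sum is `S_j = M_{bj,b} + h(X_{bj}) − h(X_{bj+b})`, so `S_j² = M_{bj,b}² + 2 M_{bj,b}(h(X_{bj}) − h(X_{bj+b})) + O(1)`;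
at the CLT scale `1/(√a b)` the cross terms must vanish.  This file provides the three estimates:
the START term `Σ_j M_{bj,b} h(X_{bj})` is a sum of orthogonal block-martingale terms
(`E[(Σ_j ·)²] ≤ a b C_h⁴`); the END term `Σ_j M_{bj,b} h(X_{bj+b})` is split by the block Markov
property (`Scoring/ChainBlockMarkov.lean`, `Scoring/ChainBlockAverages.lean`) into a sum of
conditionally centred, orthogonal blocks (`E[(Σ_j ·)²] ≤ 4 a b C_h⁴`) plus the conditional means
`φ_b(X_{bj}) = E_{X_{bj}}[M_{0,b} h(X_b)]`, which are UNIFORMLY `O(1)` under the geometric envelope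
because an increment sees a later observable only through the envelope
(`Scoring/ChainIncrementFutureDecorrelation.lean`): `|φ_b| ≤ 4 C_h² A/(1−ρ)`.

## Content: `blockMartingale_shift`, **`chain_blockMartingale_orthogonal`** (`E[G · M_{s,n}] = 0`),
**`chain_sum_blockMartingale_mul_start_sq_le`**, **`abs_chain_dirac_blockMartingale_mul_end_le_of_envelope`**,
**`chain_sum_blockMartingale_mul_end_centred_sq_le`** (statements as in the title).
NOT CLAIMED: sharp constants; unbounded `h`. -/

noncomputable section

namespace Summit.Ventures.LatticeQCDFlow.Scoring

open MeasureTheory ProbabilityTheory Filter Finset Preorder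
open scoped ENNReal Topology

variable {Ω : Type*} [MeasurableSpace Ω]

section Chain

variable (κ : Kernel Ω Ω) [IsMarkovKernel κ]

omit [IsMarkovKernel κ] in
/-- `M_{0,b}(θ_s x) = M_{s,b}(x)`. -/
theorem blockMartingale_shift (h : Ω → ℝ) (x : ℕ → Ω) (s b : ℕ) :
    (∑ r ∈ Finset.range b, (h ((fun n => x (s + n)) (0 + r + 1)) - kop κ h ((fun n => x (s + n)) (0 + r)))) = (∑ r ∈ Finset.range b, (h (x (s + r + 1)) - kop κ h (x (s + r)))) := by
  simp only [zero_add, ← add_assoc]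

variable (μ₀ : Measure Ω) [IsProbabilityMeasure μ₀]

/-- **THE BLOCK MARTINGALE IS ORTHOGONAL TO THE PAST**: `E_{μ₀}[G · M_{s,n}] = 0` for bounded
measurable `G` with `DependsOn G (Set.Iic s)`. -/
theorem chain_blockMartingale_orthogonal {h : Ω → ℝ} (hh : Measurable h) {Ch : ℝ}
    (hCh : ∀ x, |h x| ≤ Ch) (s n : ℕ) {G : (ℕ → Ω) → ℝ} (hG : Measurable G)
    (hGd : DependsOn G (Set.Iic s)) {CG : ℝ} (hCG : ∀ x, |G x| ≤ CG) :
    ∫ x, G x * (∑ r ∈ Finset.range n, (h (x (s + r + 1)) - kop κ h (x (s + r)))) ∂(Kernel.trajMeasure (X := fun _ : ℕ => Ω) (μ₀)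
          (fun n : ℕ => κ.comap (fun h' : (i : ↥(Finset.Iic n)) → Ω => h' ⟨n, Finset.mem_Iic.2 le_rfl⟩)
            (measurable_pi_apply _))) = 0 := by
  set P := (Kernel.trajMeasure (X := fun _ : ℕ => Ω) (μ₀)
        (fun n : ℕ => κ.comap (fun h' : (i : ↥(Finset.Iic n)) → Ω => h' ⟨n, Finset.mem_Iic.2 le_rfl⟩)
          (measurable_pi_apply _))) with hP
  have hCG0 : 0 ≤ CG := (abs_nonneg _).trans (hCG (fun _ => Classical.choice
    (nonempty_of_isProbabilityMeasure μ₀)))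
  have hterm : ∀ r ∈ Finset.range n,
      ∫ x, G x * (h (x (s + r + 1)) - kop κ h (x (s + r))) ∂P = 0 := by
    intro r _
    have hGd' : DependsOn G (Set.Iic (s + r)) := fun x y hxy =>
      hGd fun i hi => hxy i (Set.mem_Iic.2 ((Set.mem_Iic.1 hi).trans (Nat.le_add_right s r)))
    have := chain_increment_orthogonal κ μ₀ (s + r) hG hGd' hCG hh hCh
    rwa [← hP] at this
  have hint : ∀ r ∈ Finset.range n,
      Integrable (fun x : ℕ → Ω => G x * (h (x (s + r + 1)) - kop κ h (x (s + r)))) P := by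
    intro r _
    refine integrable_of_bounded P (hG.mul ((hh.comp (measurable_pi_apply _)).sub
      ((measurable_kop κ hh).comp (measurable_pi_apply _)))) (C := CG * (2 * Ch)) fun x => ?_
    rw [abs_mul]
    exact mul_le_mul (hCG x) ((abs_sub _ _).trans (by
      linarith [hCh (x (s + r + 1)), abs_kop_le κ hCh (x (s + r))])) (abs_nonneg _) hCG0
  simp_rw [Finset.mul_sum]
  rw [integral_finsetSum _ hint]
  exact Finset.sum_eq_zero hterm

/-- **THE START TERM**: `E_{μ₀}[(Σ_{j<a} M_{bj,b} h(X_{bj}))²] ≤ a b C_h⁴` (the summands are orthogonal,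
each with second moment `≤ C_h² · b C_h²`). -/
theorem chain_sum_blockMartingale_mul_start_sq_le {h : Ω → ℝ} (hh : Measurable h) {Ch : ℝ}
    (hCh : ∀ x, |h x| ≤ Ch) (a b : ℕ) :
    ∫ x, (∑ j ∈ Finset.range a, (∑ r ∈ Finset.range b, (h (x (b * j + r + 1)) - kop κ h (x (b * j + r)))) * h (x (b * j))) ^ 2 ∂(Kernel.trajMeasure (X := fun _ : ℕ => Ω) (μ₀)
          (fun n : ℕ => κ.comap (fun h' : (i : ↥(Finset.Iic n)) → Ω => h' ⟨n, Finset.mem_Iic.2 le_rfl⟩)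
            (measurable_pi_apply _)))
      ≤ (a : ℝ) * b * Ch ^ 4 := by
  set P := (Kernel.trajMeasure (X := fun _ : ℕ => Ω) (μ₀)
        (fun n : ℕ => κ.comap (fun h' : (i : ↥(Finset.Iic n)) → Ω => h' ⟨n, Finset.mem_Iic.2 le_rfl⟩)
          (measurable_pi_apply _))) with hP
  have hC0 : 0 ≤ Ch := (abs_nonneg _).trans (hCh (Classical.choice
    (nonempty_of_isProbabilityMeasure μ₀)))
  have hAm : ∀ j, Measurable fun x : ℕ → Ω => (∑ r ∈ Finset.range b, (h (x (b * j + r + 1)) - kop κ h (x (b * j + r)))) * h (x (b * j)) := fun j =>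
    (blockMartingale_measurable κ hh _ _).mul (hh.comp (measurable_pi_apply _))
  have hAb : ∀ j (x : ℕ → Ω), |(∑ r ∈ Finset.range b, (h (x (b * j + r + 1)) - kop κ h (x (b * j + r)))) * h (x (b * j))| ≤ b * (2 * Ch) * Ch := fun j x => by
    rw [abs_mul]; exact mul_le_mul (abs_blockMartingale_le κ hCh _ _ x) (hCh _) (abs_nonneg _)
      (by positivity)
  have hprod : ∀ j k, Integrable (fun x : ℕ → Ω =>
      ((∑ r ∈ Finset.range b, (h (x (b * j + r + 1)) - kop κ h (x (b * j + r)))) * h (x (b * j))) * ((∑ r ∈ Finset.range b, (h (x (b * k + r + 1)) - kop κ h (x (b * k + r)))) * h (x (b * k)))) P := fun j k =>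
    integrable_of_bounded P ((hAm j).mul (hAm k)) (C := (b * (2 * Ch) * Ch) * (b * (2 * Ch) * Ch))
      fun x => by rw [abs_mul]; exact mul_le_mul (hAb j x) (hAb k x) (abs_nonneg _) (by positivity)
  have horth : ∀ j k, j < k → ∫ x, ((∑ r ∈ Finset.range b, (h (x (b * j + r + 1)) - kop κ h (x (b * j + r)))) * h (x (b * j)))
      * ((∑ r ∈ Finset.range b, (h (x (b * k + r + 1)) - kop κ h (x (b * k + r)))) * h (x (b * k))) ∂P = 0 := by
    intro j k hjk
    have hle : b * j + b ≤ b * k := by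
      rw [← Nat.mul_succ]; exact Nat.mul_le_mul_left b (Nat.succ_le_of_lt hjk)
    have hGm : Measurable fun x : ℕ → Ω => (∑ r ∈ Finset.range b, (h (x (b * j + r + 1)) - kop κ h (x (b * j + r)))) * h (x (b * j)) * h (x (b * k)) :=
      (hAm j).mul (hh.comp (measurable_pi_apply _))
    have hGd : DependsOn (fun x : ℕ → Ω => (∑ r ∈ Finset.range b, (h (x (b * j + r + 1)) - kop κ h (x (b * j + r)))) * h (x (b * j)) * h (x (b * k)))
        (Set.Iic (b * k)) := by
      intro x y hxy
      have hM := blockMartingale_dependsOn (kop κ) h (b * j) b (x := x) (y := y) fun i hi =>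
        hxy i (Set.mem_Iic.2 ((Set.mem_Iic.1 hi).trans hle))
      have h1 : x (b * j) = y (b * j) := hxy _ (Set.mem_Iic.2 ((Nat.le_add_right _ _).trans hle))
      have h2 : x (b * k) = y (b * k) := hxy _ (Set.mem_Iic.2 le_rfl)
      dsimp only at hM ⊢
      rw [hM, h1, h2]
    have hGb : ∀ x : ℕ → Ω, |(∑ r ∈ Finset.range b, (h (x (b * j + r + 1)) - kop κ h (x (b * j + r)))) * h (x (b * j)) * h (x (b * k))| ≤ b * (2 * Ch) * Ch * Ch :=
      fun x => by rw [abs_mul]; exact mul_le_mul (hAb j x) (hCh _) (abs_nonneg _) (by positivity)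
    have key := chain_blockMartingale_orthogonal κ μ₀ hh hCh (b * k) b hGm hGd hGb
    rw [← hP] at key
    rw [← key]
    exact integral_congr_ae (ae_of_all _ fun x => by ring)
  have hdiag : ∀ j, ∫ x, ((∑ r ∈ Finset.range b, (h (x (b * j + r + 1)) - kop κ h (x (b * j + r)))) * h (x (b * j))) * ((∑ r ∈ Finset.range b, (h (x (b * j + r + 1)) - kop κ h (x (b * j + r)))) * h (x (b * j))) ∂P
      ≤ b * Ch ^ 4 := by
    intro j
    have hM2 := chain_blockMartingale_sq_le κ μ₀ hh hCh (b * j) b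
    rw [← hP] at hM2
    have hiM2 : Integrable (fun x : ℕ → Ω => (∑ r ∈ Finset.range b, (h (x (b * j + r + 1)) - kop κ h (x (b * j + r)))) ^ 2) P :=
      integrable_of_bounded P ((blockMartingale_measurable κ hh _ _).pow_const 2)
        (C := (b * (2 * Ch)) ^ 2) fun x => by
          rw [abs_pow]; exact pow_le_pow_left₀ (abs_nonneg _) (abs_blockMartingale_le κ hCh _ _ x) 2
    calc ∫ x, ((∑ r ∈ Finset.range b, (h (x (b * j + r + 1)) - kop κ h (x (b * j + r)))) * h (x (b * j))) * ((∑ r ∈ Finset.range b, (h (x (b * j + r + 1)) - kop κ h (x (b * j + r)))) * h (x (b * j))) ∂P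
        ≤ ∫ x, Ch ^ 2 * (∑ r ∈ Finset.range b, (h (x (b * j + r + 1)) - kop κ h (x (b * j + r)))) ^ 2 ∂P := by
          refine integral_mono_of_nonneg (ae_of_all _ fun x => ?_) (hiM2.const_mul _)
            (ae_of_all _ fun x => ?_)
          · exact mul_self_nonneg _
          · have hhx := hCh (x (b * j))
            rw [abs_le] at hhx
            have : ((∑ r ∈ Finset.range b, (h (x (b * j + r + 1)) - kop κ h (x (b * j + r)))) * h (x (b * j))) * ((∑ r ∈ Finset.range b, (h (x (b * j + r + 1)) - kop κ h (x (b * j + r)))) * h (x (b * j)))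
                = h (x (b * j)) ^ 2 * (∑ r ∈ Finset.range b, (h (x (b * j + r + 1)) - kop κ h (x (b * j + r)))) ^ 2 := by ring
            dsimp only
            rw [this]
            refine mul_le_mul_of_nonneg_right ?_ (sq_nonneg _)
            nlinarith
      _ = Ch ^ 2 * ∫ x, (∑ r ∈ Finset.range b, (h (x (b * j + r + 1)) - kop κ h (x (b * j + r)))) ^ 2 ∂P := integral_const_mul _ _
      _ ≤ Ch ^ 2 * (b * Ch ^ 2) := mul_le_mul_of_nonneg_left hM2 (sq_nonneg _)
      _ = b * Ch ^ 4 := by ring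
  have hexp : ∀ x : ℕ → Ω, (∑ j ∈ Finset.range a, (∑ r ∈ Finset.range b, (h (x (b * j + r + 1)) - kop κ h (x (b * j + r)))) * h (x (b * j))) ^ 2
      = ∑ j ∈ Finset.range a, ∑ k ∈ Finset.range a,
        ((∑ r ∈ Finset.range b, (h (x (b * j + r + 1)) - kop κ h (x (b * j + r)))) * h (x (b * j))) * ((∑ r ∈ Finset.range b, (h (x (b * k + r + 1)) - kop κ h (x (b * k + r)))) * h (x (b * k))) := fun x => by
    rw [sq, Finset.sum_mul_sum]
  rw [integral_congr_ae (ae_of_all _ hexp),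
    integral_finsetSum _ (fun j _ => integrable_finsetSum _ fun k _ => hprod j k)]
  have hrow : ∀ j ∈ Finset.range a, ∫ x, ∑ k ∈ Finset.range a,
      ((∑ r ∈ Finset.range b, (h (x (b * j + r + 1)) - kop κ h (x (b * j + r)))) * h (x (b * j))) * ((∑ r ∈ Finset.range b, (h (x (b * k + r + 1)) - kop κ h (x (b * k + r)))) * h (x (b * k))) ∂P ≤ b * Ch ^ 4 := by
    intro j hj
    rw [integral_finsetSum _ (fun k _ => hprod j k), Finset.sum_eq_single_of_mem j hj
      (fun k _ hkj => by
        rcases lt_or_gt_of_ne hkj with hlt | hgt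
        · rw [← horth k j hlt]
          exact integral_congr_ae (ae_of_all _ fun x => mul_comm _ _)
        · exact horth j k hgt)]
    exact hdiag j
  calc ∑ j ∈ Finset.range a, ∫ x, ∑ k ∈ Finset.range a,
        ((∑ r ∈ Finset.range b, (h (x (b * j + r + 1)) - kop κ h (x (b * j + r)))) * h (x (b * j))) * ((∑ r ∈ Finset.range b, (h (x (b * k + r + 1)) - kop κ h (x (b * k + r)))) * h (x (b * k))) ∂P
      ≤ ∑ _j ∈ Finset.range a, (b : ℝ) * Ch ^ 4 := Finset.sum_le_sum hrow
    _ = (a : ℝ) * b * Ch ^ 4 := by rw [Finset.sum_const, Finset.card_range, nsmul_eq_mul]; ring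

/-- **THE CENTRED END TERM**: with `φ_b(z) = E_z[M_{0,b} h(X_b)]`,
`E_{μ₀}[(Σ_{j<a} (M_{bj,b} h(X_{bj+b}) − φ_b(X_{bj})))²] ≤ 4 a b C_h⁴`. -/
theorem chain_sum_blockMartingale_mul_end_centred_sq_le {h : Ω → ℝ} (hh : Measurable h) {Ch : ℝ}
    (hCh : ∀ x, |h x| ≤ Ch) (a b : ℕ) :
    ∫ x, (∑ j ∈ Finset.range a, ((∑ r ∈ Finset.range b, (h (x (b * j + r + 1)) - kop κ h (x (b * j + r)))) * h (x (b * j + b))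
        - ∫ y, (∑ r ∈ Finset.range b, (h (y (0 + r + 1)) - kop κ h (y (0 + r)))) * h (y b) ∂(Kernel.trajMeasure (X := fun _ : ℕ => Ω) (Measure.dirac (x (b * j)))
              (fun n : ℕ => κ.comap (fun h' : (i : ↥(Finset.Iic n)) → Ω => h' ⟨n, Finset.mem_Iic.2 le_rfl⟩)
                (measurable_pi_apply _))))) ^ 2 ∂(Kernel.trajMeasure (X := fun _ : ℕ => Ω) (μ₀)
              (fun n : ℕ => κ.comap (fun h' : (i : ↥(Finset.Iic n)) → Ω => h' ⟨n, Finset.mem_Iic.2 le_rfl⟩)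
                (measurable_pi_apply _)))
      ≤ 4 * ((a : ℝ) * b * Ch ^ 4) := by
  set P := (Kernel.trajMeasure (X := fun _ : ℕ => Ω) (μ₀)
        (fun n : ℕ => κ.comap (fun h' : (i : ↥(Finset.Iic n)) → Ω => h' ⟨n, Finset.mem_Iic.2 le_rfl⟩)
          (measurable_pi_apply _))) with hP
  have hC0 : 0 ≤ Ch := (abs_nonneg _).trans (hCh (Classical.choice
    (nonempty_of_isProbabilityMeasure μ₀)))
  have hΨm : Measurable fun y : ℕ → Ω => (∑ r ∈ Finset.range b, (h (y (0 + r + 1)) - kop κ h (y (0 + r)))) * h (y b) :=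
    (blockMartingale_measurable κ hh 0 b).mul (hh.comp (measurable_pi_apply _))
  have hΨd : DependsOn (fun y : ℕ → Ω => (∑ r ∈ Finset.range b, (h (y (0 + r + 1)) - kop κ h (y (0 + r)))) * h (y b)) (Set.Iic b) := by
    intro x y hxy
    have hM := blockMartingale_dependsOn (kop κ) h 0 b (x := x) (y := y) fun i hi =>
      hxy i (by simpa using hi)
    have h1 : x b = y b := hxy _ (Set.mem_Iic.2 le_rfl)
    dsimp only at hM ⊢
    rw [hM, h1]
  have hΨb : ∀ y : ℕ → Ω, |(∑ r ∈ Finset.range b, (h (y (0 + r + 1)) - kop κ h (y (0 + r)))) * h (y b)| ≤ b * (2 * Ch) * Ch := fun y => by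
    rw [abs_mul]; exact mul_le_mul (abs_blockMartingale_le κ hCh 0 b y) (hCh _) (abs_nonneg _)
      (by positivity)
  have hV : ∀ z : Ω, ∫ y, ((∑ r ∈ Finset.range b, (h (y (0 + r + 1)) - kop κ h (y (0 + r)))) * h (y b)) ^ 2 ∂(Kernel.trajMeasure (X := fun _ : ℕ => Ω) (Measure.dirac z)
        (fun n : ℕ => κ.comap (fun h' : (i : ↥(Finset.Iic n)) → Ω => h' ⟨n, Finset.mem_Iic.2 le_rfl⟩)
          (measurable_pi_apply _))) ≤ b * Ch ^ 4 := by
    intro z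
    have hM2 := chain_blockMartingale_sq_le κ (Measure.dirac z) hh hCh 0 b
    have hiM2 : Integrable (fun y : ℕ → Ω => (∑ r ∈ Finset.range b, (h (y (0 + r + 1)) - kop κ h (y (0 + r)))) ^ 2) (Kernel.trajMeasure (X := fun _ : ℕ => Ω) (Measure.dirac z)
          (fun n : ℕ => κ.comap (fun h' : (i : ↥(Finset.Iic n)) → Ω => h' ⟨n, Finset.mem_Iic.2 le_rfl⟩)
            (measurable_pi_apply _))) :=
      integrable_of_bounded _ ((blockMartingale_measurable κ hh 0 b).pow_const 2)
        (C := (b * (2 * Ch)) ^ 2) fun y => by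
          rw [abs_pow]; exact pow_le_pow_left₀ (abs_nonneg _) (abs_blockMartingale_le κ hCh 0 b y) 2
    calc ∫ y, ((∑ r ∈ Finset.range b, (h (y (0 + r + 1)) - kop κ h (y (0 + r)))) * h (y b)) ^ 2 ∂(Kernel.trajMeasure (X := fun _ : ℕ => Ω) (Measure.dirac z)
          (fun n : ℕ => κ.comap (fun h' : (i : ↥(Finset.Iic n)) → Ω => h' ⟨n, Finset.mem_Iic.2 le_rfl⟩)
            (measurable_pi_apply _)))
        ≤ ∫ y, Ch ^ 2 * (∑ r ∈ Finset.range b, (h (y (0 + r + 1)) - kop κ h (y (0 + r)))) ^ 2 ∂(Kernel.trajMeasure (X := fun _ : ℕ => Ω) (Measure.dirac z)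
              (fun n : ℕ => κ.comap (fun h' : (i : ↥(Finset.Iic n)) → Ω => h' ⟨n, Finset.mem_Iic.2 le_rfl⟩)
                (measurable_pi_apply _))) := by
          refine integral_mono_of_nonneg (ae_of_all _ fun y => sq_nonneg _) (hiM2.const_mul _)
            (ae_of_all _ fun y => ?_)
          have hhy := hCh (y b)
          rw [abs_le] at hhy
          dsimp only
          rw [mul_pow, mul_comm]
          exact mul_le_mul_of_nonneg_right (by nlinarith) (sq_nonneg _)
      _ = Ch ^ 2 * ∫ y, (∑ r ∈ Finset.range b, (h (y (0 + r + 1)) - kop κ h (y (0 + r)))) ^ 2 ∂(Kernel.trajMeasure (X := fun _ : ℕ => Ω) (Measure.dirac z)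
            (fun n : ℕ => κ.comap (fun h' : (i : ↥(Finset.Iic n)) → Ω => h' ⟨n, Finset.mem_Iic.2 le_rfl⟩)
              (measurable_pi_apply _))) := integral_const_mul _ _
      _ ≤ Ch ^ 2 * (b * Ch ^ 2) := mul_le_mul_of_nonneg_left hM2 (sq_nonneg _)
      _ = b * Ch ^ 4 := by ring
  have hshift : ∀ (x : ℕ → Ω) (j : ℕ),
      (fun y : ℕ → Ω => (∑ r ∈ Finset.range b, (h (y (0 + r + 1)) - kop κ h (y (0 + r)))) * h (y b)) (fun n => x (b * j + n))
        = (∑ r ∈ Finset.range b, (h (x (b * j + r + 1)) - kop κ h (x (b * j + r)))) * h (x (b * j + b)) := by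
    intro x j
    show (∑ r ∈ Finset.range b, (h ((fun n => x (b * j + n)) (0 + r + 1)) - kop κ h ((fun n => x (b * j + n)) (0 + r)))) * h (x (b * j + b)) = _
    rw [blockMartingale_shift κ h x (b * j) b]
  have hYm : ∀ j, Measurable fun x : ℕ → Ω => ((∑ r ∈ Finset.range b, (h (x (b * j + r + 1)) - kop κ h (x (b * j + r)))) * h (x (b * j + b))
      - ∫ y, (∑ r ∈ Finset.range b, (h (y (0 + r + 1)) - kop κ h (y (0 + r)))) * h (y b) ∂(Kernel.trajMeasure (X := fun _ : ℕ => Ω) (Measure.dirac (x (b * j)))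
            (fun n : ℕ => κ.comap (fun h' : (i : ↥(Finset.Iic n)) → Ω => h' ⟨n, Finset.mem_Iic.2 le_rfl⟩)
              (measurable_pi_apply _)))) := fun j =>
    ((blockMartingale_measurable κ hh _ _).mul (hh.comp (measurable_pi_apply _))).sub
      ((measurable_chain_dirac_integral κ hΨm).comp (measurable_pi_apply _))
  have hYb : ∀ j (x : ℕ → Ω), |(∑ r ∈ Finset.range b, (h (x (b * j + r + 1)) - kop κ h (x (b * j + r)))) * h (x (b * j + b))
      - ∫ y, (∑ r ∈ Finset.range b, (h (y (0 + r + 1)) - kop κ h (y (0 + r)))) * h (y b) ∂(Kernel.trajMeasure (X := fun _ : ℕ => Ω) (Measure.dirac (x (b * j)))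
            (fun n : ℕ => κ.comap (fun h' : (i : ↥(Finset.Iic n)) → Ω => h' ⟨n, Finset.mem_Iic.2 le_rfl⟩)
              (measurable_pi_apply _)))|
      ≤ b * (2 * Ch) * Ch + b * (2 * Ch) * Ch := fun j x =>
    (abs_sub _ _).trans (add_le_add (by
      rw [abs_mul]; exact mul_le_mul (abs_blockMartingale_le κ hCh _ _ x) (hCh _) (abs_nonneg _)
        (by positivity)) (abs_chain_dirac_integral_le κ hΨb _))
  have hprod : ∀ j k, Integrable (fun x : ℕ → Ω =>
      ((∑ r ∈ Finset.range b, (h (x (b * j + r + 1)) - kop κ h (x (b * j + r)))) * h (x (b * j + b)) - ∫ y, (∑ r ∈ Finset.range b, (h (y (0 + r + 1)) - kop κ h (y (0 + r)))) * h (y b) ∂(Kernel.trajMeasure (X := fun _ : ℕ => Ω) (Measure.dirac (x (b * j)))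
            (fun n : ℕ => κ.comap (fun h' : (i : ↥(Finset.Iic n)) → Ω => h' ⟨n, Finset.mem_Iic.2 le_rfl⟩)
              (measurable_pi_apply _))))
      * ((∑ r ∈ Finset.range b, (h (x (b * k + r + 1)) - kop κ h (x (b * k + r)))) * h (x (b * k + b))
        - ∫ y, (∑ r ∈ Finset.range b, (h (y (0 + r + 1)) - kop κ h (y (0 + r)))) * h (y b) ∂(Kernel.trajMeasure (X := fun _ : ℕ => Ω) (Measure.dirac (x (b * k)))
              (fun n : ℕ => κ.comap (fun h' : (i : ↥(Finset.Iic n)) → Ω => h' ⟨n, Finset.mem_Iic.2 le_rfl⟩)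
                (measurable_pi_apply _))))) P := fun j k =>
    integrable_of_bounded P ((hYm j).mul (hYm k))
      (C := (b * (2 * Ch) * Ch + b * (2 * Ch) * Ch) * (b * (2 * Ch) * Ch + b * (2 * Ch) * Ch))
      fun x => by rw [abs_mul]; exact mul_le_mul (hYb j x) (hYb k x) (abs_nonneg _) (by positivity)
  have horth : ∀ j k, j ≠ k → ∫ x,
      ((∑ r ∈ Finset.range b, (h (x (b * j + r + 1)) - kop κ h (x (b * j + r)))) * h (x (b * j + b)) - ∫ y, (∑ r ∈ Finset.range b, (h (y (0 + r + 1)) - kop κ h (y (0 + r)))) * h (y b) ∂(Kernel.trajMeasure (X := fun _ : ℕ => Ω) (Measure.dirac (x (b * j)))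
            (fun n : ℕ => κ.comap (fun h' : (i : ↥(Finset.Iic n)) → Ω => h' ⟨n, Finset.mem_Iic.2 le_rfl⟩)
              (measurable_pi_apply _))))
      * ((∑ r ∈ Finset.range b, (h (x (b * k + r + 1)) - kop κ h (x (b * k + r)))) * h (x (b * k + b))
        - ∫ y, (∑ r ∈ Finset.range b, (h (y (0 + r + 1)) - kop κ h (y (0 + r)))) * h (y b) ∂(Kernel.trajMeasure (X := fun _ : ℕ => Ω) (Measure.dirac (x (b * k)))
              (fun n : ℕ => κ.comap (fun h' : (i : ↥(Finset.Iic n)) → Ω => h' ⟨n, Finset.mem_Iic.2 le_rfl⟩)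
                (measurable_pi_apply _)))) ∂P = 0 := by
    intro j k hjk
    have key := chain_block_centred_orthogonal κ μ₀ hΨm hΨd hΨb hjk
    rw [← hP] at key
    simp only [hshift] at key
    exact key
  have hdiag : ∀ j, ∫ x,
      ((∑ r ∈ Finset.range b, (h (x (b * j + r + 1)) - kop κ h (x (b * j + r)))) * h (x (b * j + b)) - ∫ y, (∑ r ∈ Finset.range b, (h (y (0 + r + 1)) - kop κ h (y (0 + r)))) * h (y b) ∂(Kernel.trajMeasure (X := fun _ : ℕ => Ω) (Measure.dirac (x (b * j)))
            (fun n : ℕ => κ.comap (fun h' : (i : ↥(Finset.Iic n)) → Ω => h' ⟨n, Finset.mem_Iic.2 le_rfl⟩)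
              (measurable_pi_apply _))))
      * ((∑ r ∈ Finset.range b, (h (x (b * j + r + 1)) - kop κ h (x (b * j + r)))) * h (x (b * j + b))
        - ∫ y, (∑ r ∈ Finset.range b, (h (y (0 + r + 1)) - kop κ h (y (0 + r)))) * h (y b) ∂(Kernel.trajMeasure (X := fun _ : ℕ => Ω) (Measure.dirac (x (b * j)))
              (fun n : ℕ => κ.comap (fun h' : (i : ↥(Finset.Iic n)) → Ω => h' ⟨n, Finset.mem_Iic.2 le_rfl⟩)
                (measurable_pi_apply _)))) ∂P ≤ 4 * (b * Ch ^ 4) := by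
    intro j
    have key := chain_block_centred_sq_integral_le κ μ₀ hΨm b hΨb hV j
    rw [← hP] at key
    simp only [hshift] at key
    simpa only [sq] using key
  have hexp : ∀ x : ℕ → Ω, (∑ j ∈ Finset.range a, ((∑ r ∈ Finset.range b, (h (x (b * j + r + 1)) - kop κ h (x (b * j + r)))) * h (x (b * j + b))
        - ∫ y, (∑ r ∈ Finset.range b, (h (y (0 + r + 1)) - kop κ h (y (0 + r)))) * h (y b) ∂(Kernel.trajMeasure (X := fun _ : ℕ => Ω) (Measure.dirac (x (b * j)))
              (fun n : ℕ => κ.comap (fun h' : (i : ↥(Finset.Iic n)) → Ω => h' ⟨n, Finset.mem_Iic.2 le_rfl⟩)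
                (measurable_pi_apply _))))) ^ 2
      = ∑ j ∈ Finset.range a, ∑ k ∈ Finset.range a,
        ((∑ r ∈ Finset.range b, (h (x (b * j + r + 1)) - kop κ h (x (b * j + r)))) * h (x (b * j + b)) - ∫ y, (∑ r ∈ Finset.range b, (h (y (0 + r + 1)) - kop κ h (y (0 + r)))) * h (y b) ∂(Kernel.trajMeasure (X := fun _ : ℕ => Ω) (Measure.dirac (x (b * j)))
              (fun n : ℕ => κ.comap (fun h' : (i : ↥(Finset.Iic n)) → Ω => h' ⟨n, Finset.mem_Iic.2 le_rfl⟩)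
                (measurable_pi_apply _))))
        * ((∑ r ∈ Finset.range b, (h (x (b * k + r + 1)) - kop κ h (x (b * k + r)))) * h (x (b * k + b))
          - ∫ y, (∑ r ∈ Finset.range b, (h (y (0 + r + 1)) - kop κ h (y (0 + r)))) * h (y b) ∂(Kernel.trajMeasure (X := fun _ : ℕ => Ω) (Measure.dirac (x (b * k)))
                (fun n : ℕ => κ.comap (fun h' : (i : ↥(Finset.Iic n)) → Ω => h' ⟨n, Finset.mem_Iic.2 le_rfl⟩)
                  (measurable_pi_apply _)))) := fun x => by
    rw [sq, Finset.sum_mul_sum]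
  rw [integral_congr_ae (ae_of_all _ hexp),
    integral_finsetSum _ (fun j _ => integrable_finsetSum _ fun k _ => hprod j k)]
  have hrow : ∀ j ∈ Finset.range a, ∫ x, ∑ k ∈ Finset.range a,
      ((∑ r ∈ Finset.range b, (h (x (b * j + r + 1)) - kop κ h (x (b * j + r)))) * h (x (b * j + b)) - ∫ y, (∑ r ∈ Finset.range b, (h (y (0 + r + 1)) - kop κ h (y (0 + r)))) * h (y b) ∂(Kernel.trajMeasure (X := fun _ : ℕ => Ω) (Measure.dirac (x (b * j)))
            (fun n : ℕ => κ.comap (fun h' : (i : ↥(Finset.Iic n)) → Ω => h' ⟨n, Finset.mem_Iic.2 le_rfl⟩)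
              (measurable_pi_apply _))))
      * ((∑ r ∈ Finset.range b, (h (x (b * k + r + 1)) - kop κ h (x (b * k + r)))) * h (x (b * k + b))
        - ∫ y, (∑ r ∈ Finset.range b, (h (y (0 + r + 1)) - kop κ h (y (0 + r)))) * h (y b) ∂(Kernel.trajMeasure (X := fun _ : ℕ => Ω) (Measure.dirac (x (b * k)))
              (fun n : ℕ => κ.comap (fun h' : (i : ↥(Finset.Iic n)) → Ω => h' ⟨n, Finset.mem_Iic.2 le_rfl⟩)
                (measurable_pi_apply _)))) ∂P ≤ 4 * (b * Ch ^ 4) := by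
    intro j hj
    rw [integral_finsetSum _ (fun k _ => hprod j k),
      Finset.sum_eq_single_of_mem j hj (fun k _ hkj => horth j k (Ne.symm hkj))]
    exact hdiag j
  calc ∑ j ∈ Finset.range a, ∫ x, ∑ k ∈ Finset.range a,
        ((∑ r ∈ Finset.range b, (h (x (b * j + r + 1)) - kop κ h (x (b * j + r)))) * h (x (b * j + b)) - ∫ y, (∑ r ∈ Finset.range b, (h (y (0 + r + 1)) - kop κ h (y (0 + r)))) * h (y b) ∂(Kernel.trajMeasure (X := fun _ : ℕ => Ω) (Measure.dirac (x (b * j)))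
              (fun n : ℕ => κ.comap (fun h' : (i : ↥(Finset.Iic n)) → Ω => h' ⟨n, Finset.mem_Iic.2 le_rfl⟩)
                (measurable_pi_apply _))))
        * ((∑ r ∈ Finset.range b, (h (x (b * k + r + 1)) - kop κ h (x (b * k + r)))) * h (x (b * k + b))
          - ∫ y, (∑ r ∈ Finset.range b, (h (y (0 + r + 1)) - kop κ h (y (0 + r)))) * h (y b) ∂(Kernel.trajMeasure (X := fun _ : ℕ => Ω) (Measure.dirac (x (b * k)))
                (fun n : ℕ => κ.comap (fun h' : (i : ↥(Finset.Iic n)) → Ω => h' ⟨n, Finset.mem_Iic.2 le_rfl⟩)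
                  (measurable_pi_apply _)))) ∂P
      ≤ ∑ _j ∈ Finset.range a, 4 * ((b : ℝ) * Ch ^ 4) := Finset.sum_le_sum hrow
    _ = 4 * ((a : ℝ) * b * Ch ^ 4) := by rw [Finset.sum_const, Finset.card_range, nsmul_eq_mul]; ring

end Chain

section Envelope

variable {κ : Kernel Ω Ω} [IsMarkovKernel κ] {π : Measure Ω} {A ρ : ℝ}

/-- **THE CONDITIONAL MEAN OF THE END TERM IS UNIFORMLY BOUNDED**: under the envelope `(A, ρ)`
(`0 ≤ A`, `0 ≤ ρ < 1`), for every state `z` and every `b`: `|E_z[M_{0,b} h(X_b)]| ≤ 4 C_h² A/(1−ρ)`. -/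
theorem abs_chain_dirac_blockMartingale_mul_end_le_of_envelope
    (henv : ∀ (g : Ω → ℝ), Measurable g → ∀ (Cg : ℝ), (∀ x, |g x| ≤ Cg) →
      ∀ (t : ℕ) (x : Ω), |(kop κ)^[t] g x - ∫ y, g y ∂π| ≤ 2 * Cg * (A * ρ ^ t))
    (hA : 0 ≤ A) (hρ0 : 0 ≤ ρ) (hρ1 : ρ < 1)
    {h : Ω → ℝ} (hh : Measurable h) {Ch : ℝ} (hCh : ∀ x, |h x| ≤ Ch) (z : Ω) (b : ℕ) :
    |∫ y, (∑ r ∈ Finset.range b, (h (y (0 + r + 1)) - kop κ h (y (0 + r)))) * h (y b) ∂(Kernel.trajMeasure (X := fun _ : ℕ => Ω) (Measure.dirac z)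
          (fun n : ℕ => κ.comap (fun h' : (i : ↥(Finset.Iic n)) → Ω => h' ⟨n, Finset.mem_Iic.2 le_rfl⟩)
            (measurable_pi_apply _)))| ≤ 4 * Ch ^ 2 * A / (1 - ρ) := by
  set P := (Kernel.trajMeasure (X := fun _ : ℕ => Ω) (Measure.dirac z)
        (fun n : ℕ => κ.comap (fun h' : (i : ↥(Finset.Iic n)) → Ω => h' ⟨n, Finset.mem_Iic.2 le_rfl⟩)
          (measurable_pi_apply _))) with hP
  have hC0 : 0 ≤ Ch := (abs_nonneg _).trans (hCh z)
  have h1ρ : 0 < 1 - ρ := sub_pos.2 hρ1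
  have hterm : ∀ r ∈ Finset.range b,
      |∫ y, (h (y (0 + r + 1)) - kop κ h (y (0 + r))) * h (y b) ∂P| ≤ 4 * Ch * Ch * (A * ρ ^ (b - 1 - r)) := by
    intro r hr
    have hr' := Finset.mem_range.1 hr
    have hb_eq : b = 0 + r + 1 + (b - 1 - r) := by omega
    have key := abs_chain_increment_mul_future_le_of_envelope (κ := κ) (μ₀ := Measure.dirac z) henv
      (0 + r) (b - 1 - r) (G := fun _ => (1 : ℝ)) measurable_const
      (dependsOn_const _ |>.mono (Set.empty_subset _)) (CG := 1) (fun _ => by simp) hh hCh hh hCh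
    rw [← hP] at key
    simp only [one_mul, abs_one, integral_const, probReal_univ, smul_eq_mul, mul_one] at key
    rw [← hb_eq] at key
    exact key
  have hint : ∀ r ∈ Finset.range b,
      Integrable (fun y : ℕ → Ω => (h (y (0 + r + 1)) - kop κ h (y (0 + r))) * h (y b)) P := by
    intro r _
    refine integrable_of_bounded P ((((hh.comp (measurable_pi_apply _)).sub
      ((measurable_kop κ hh).comp (measurable_pi_apply _)))).mul (hh.comp (measurable_pi_apply _)))
      (C := 2 * Ch * Ch) fun y => ?_
    rw [abs_mul]
    exact mul_le_mul ((abs_sub _ _).trans (by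
      linarith [hCh (y (0 + r + 1)), abs_kop_le κ hCh (y (0 + r))])) (hCh _) (abs_nonneg _)
      (by positivity)
  have hgeo : ∑ r ∈ Finset.range b, ρ ^ (b - 1 - r) ≤ 1 / (1 - ρ) := by
    calc ∑ r ∈ Finset.range b, ρ ^ (b - 1 - r) = ∑ k ∈ Finset.range b, ρ ^ k :=
          Finset.sum_range_reflect (fun k => ρ ^ k) b
      _ ≤ 1 / (1 - ρ) := by
          rw [Finset.range_eq_Ico]
          have := geom_sum_Ico_le_of_lt_one (m := 0) (n := b) hρ0 hρ1
          simpa using this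
  simp_rw [Finset.sum_mul]
  rw [integral_finsetSum _ hint]
  calc |∑ r ∈ Finset.range b, ∫ y, (h (y (0 + r + 1)) - kop κ h (y (0 + r))) * h (y b) ∂P|
      ≤ ∑ r ∈ Finset.range b, |∫ y, (h (y (0 + r + 1)) - kop κ h (y (0 + r))) * h (y b) ∂P| :=
        Finset.abs_sum_le_sum_abs _ _
    _ ≤ ∑ r ∈ Finset.range b, 4 * Ch * Ch * (A * ρ ^ (b - 1 - r)) := Finset.sum_le_sum hterm
    _ = 4 * Ch ^ 2 * A * ∑ r ∈ Finset.range b, ρ ^ (b - 1 - r) := by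
        rw [Finset.mul_sum]; exact Finset.sum_congr rfl fun r _ => by ring
    _ ≤ 4 * Ch ^ 2 * A * (1 / (1 - ρ)) := mul_le_mul_of_nonneg_left hgeo (by positivity)
    _ = 4 * Ch ^ 2 * A / (1 - ρ) := by ring

end Envelope

end Summit.Ventures.LatticeQCDFlow.Scoring

end
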